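import Mathlib
import Literature.Analysis.ODE.CodeListMeanValueExtension
import Summits.Ventures.FusionMHD.Models.CerfonFreidbergNstxLikeCriticalPoint
import Summits.Ventures.FusionMHD.Models.CerfonFreidbergIterLikePlasmaSection
import HarnessLib

/-!
# Ventures/FusionMHD — Models/CerfonFreidbergNstxLikePlasmaSection.lean: NSTX-like twin — in the TALLER box `[11/50, 89/50] × [−8/5, 8/5]`
# every vertical section of the CF NSTX-like model plasma is ONE symmetric interval (kernel; 4 + 9 range certificates)

HONEST FRAMING (LADDER-GRIDFUSION three columns; CF rung, qualitative companion of S2 #47 «F1.CF-AXIS-NSTX», of «#47″ CF-MIDPLANE» and of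
`Models/CerfonFreidbergNstxLikeCriticalPoint.lean`).  The NSTX-like CriticalPoint box had height exactly `κε = 39/25`, so its lid TOUCHES the
plasma top and cannot be certified to lie in vacuum.  THIS FILE raises the lid to `Y = ±8/5`: (i) FOUR range certificates of the vertical slope
factor `H` (code list `CFIterLike.hExpr`, reused) over «(p511071's coefficient box) × (X-piece of `xPieceN`) × (W ∈ [0, 64/25])» give `H ≥ 1/200`
on the taller box, hence `U_Y` has the sign of `Y` there and every vertical section is a strict valley (`strictMonoOn_U_vertical_tall` /
`strictAntiOn_U_vertical_tall`); (ii) NINE range certificates of `U(X, 64/25; c)` (code list `CFIterLike.uExpr`, reused) over the X-pieces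
11/50 | 13/25 | 61/100 | 33/50 | 7/10 | 37/50 | 79/100 | 87/100 | 109/100 | 89/50 give **`U(X, ±8/5) ≥ 1/500 > 0`** (`U_top_pos`; the lid is
0.04 above the plasma top `κε = 39/25`).  Consequence (`plasma_section`): **for every `X ∈ (11/50, 89/50)` there is ONE height
`Y⋆ ∈ (0, 8/5)` with `U(X, ±Y⋆) = 0` and, for `|Y| ≤ 8/5`, `U(X, Y) < 0 ⟺ |Y| < Y⋆` and `U(X, Y) = 0 ⟺ |Y| = Y⋆`** — the NSTX-like model plasma in
the box is a single up–down-symmetric lens, exactly as for the ITER-like instance (`CFIterLike.plasma_section`), although its midplane flux is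
NOT convex inboard (`dRR_inboard_neg`).
CERTIFIED (kernel): as stated, for the model flux on that box.  MODELLED: analytic CF family (ideal MHD, Solov'ev profiles, fixed analytic
boundary); a sign-pattern statement, no stability content, nothing outside the box.  Typer/prover: gridfusion-model-5 (g5), 2026-08-27.
Citations: Freidberg 2014 §6.6.1 (6.151)–(6.155) [Freidberg2014]; Moore 1966 Thm 3.1 / Moore 1979 §4.3 [Moore1979].
-/

noncomputable section

open Set NonemptyInterval Matrix
open Literature.Analysis.ODE Literature.Analysis.ODE.FExpr
open Literature.Analysis.ValidatedNumerics Literature.Analysis.ValidatedNumerics.ITaylor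
open Literature.MathematicalPhysics.MHD Literature.MathematicalPhysics.MHD.GradShafranov
  Literature.MathematicalPhysics.MHD.CerfonFreidberg _root_.Real

namespace Summit.Ventures.FusionMHD.Models.CFNstxLike

/-! ## §1 Boxes and the certificates (code lists `CFIterLike.hExpr`, `CFIterLike.uExpr` reused by name) -/

/-- The taller `W = Y²` range `[0, 64/25]` (`|Y| ≤ 8/5`). -/
def wTall : Iv := ⟨(0, (64 / 25)), by decide +kernel⟩

/-- The lid `{W = 64/25}` (`Y = ±8/5`). -/
def wLidN : Iv := ⟨((64 / 25), (64 / 25)), by decide +kernel⟩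

/-- «p511071's coefficient box × X-interval `I` × W-interval `J`». -/
def boxN (I J : Iv) : Fin 9 → Iv :=
  fun i => if h : (i : ℕ) < 7 then axKrawczyk.box ⟨i, by omega⟩ else if (i : ℕ) = 7 then I else J

/-- The nine `X`-pieces of the lid. -/
def lidPieceN : Fin 9 → Iv :=
  ![⟨((11 / 50), (13 / 25)), by decide +kernel⟩,
    ⟨((13 / 25), (61 / 100)), by decide +kernel⟩,
    ⟨((61 / 100), (33 / 50)), by decide +kernel⟩,
    ⟨((33 / 50), (7 / 10)), by decide +kernel⟩,
    ⟨((7 / 10), (37 / 50)), by decide +kernel⟩,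
    ⟨((37 / 50), (79 / 100)), by decide +kernel⟩,
    ⟨((79 / 100), (87 / 100)), by decide +kernel⟩,
    ⟨((87 / 100), (109 / 100)), by decide +kernel⟩,
    ⟨((109 / 100), (89 / 50)), by decide +kernel⟩]

/-- Endpoints (decided). -/
theorem tall_eq : (wTall.fst = 0 ∧ wTall.snd = 64 / 25) ∧ (wLidN.fst = 64 / 25 ∧ wLidN.snd = 64 / 25) := by
  decide +kernel

/-- Endpoints of the lid pieces (decided). -/
theorem lidPieceN_eq :
    ((lidPieceN 0).fst = 11 / 50 ∧ (lidPieceN 0).snd = 13 / 25) ∧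
    ((lidPieceN 1).fst = 13 / 25 ∧ (lidPieceN 1).snd = 61 / 100) ∧
    ((lidPieceN 2).fst = 61 / 100 ∧ (lidPieceN 2).snd = 33 / 50) ∧
    ((lidPieceN 3).fst = 33 / 50 ∧ (lidPieceN 3).snd = 7 / 10) ∧
    ((lidPieceN 4).fst = 7 / 10 ∧ (lidPieceN 4).snd = 37 / 50) ∧
    ((lidPieceN 5).fst = 37 / 50 ∧ (lidPieceN 5).snd = 79 / 100) ∧
    ((lidPieceN 6).fst = 79 / 100 ∧ (lidPieceN 6).snd = 87 / 100) ∧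
    ((lidPieceN 7).fst = 87 / 100 ∧ (lidPieceN 7).snd = 109 / 100) ∧
    ((lidPieceN 8).fst = 109 / 100 ∧ (lidPieceN 8).snd = 89 / 50) := by
  decide +kernel

/-- **FOUR SLOPE CERTIFICATES on the taller box:** `H ∈ [1/200, 1/2]` on every `xPieceN j × [0, 64/25]`. -/
theorem hTall_range_cert : ∀ j : Fin 4,
    evalBoxLE ⟨64, 60, 56, 4, 0⟩ CFIterLike.hExpr (boxN (xPieceN j) wTall) ⟨((1 / 200), (1 / 2)), by decide +kernel⟩ = true := by
  decide +kernel

/-- **NINE LID CERTIFICATES:** `U(X, 64/25; c) ∈ [1/500, 1]` on every lid piece. -/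
theorem lidN_range_cert : ∀ j : Fin 9,
    evalBoxLE ⟨64, 60, 56, 4, 0⟩ CFIterLike.uExpr (boxN (lidPieceN j) wLidN) ⟨((1 / 500), 1), by decide +kernel⟩ = true := by
  decide +kernel

/-! ## §2 Membership -/

/-- `(coeff, X, W) ∈ boxN I J` for `X ∈ I`, `W ∈ J`. -/
theorem hPointN_mem_boxN {I J : Iv} {X W : ℝ} (hlo : (I.fst : ℝ) ≤ X) (hhi : X ≤ (I.snd : ℝ))
    (hW0 : ((J.fst : ℚ) : ℝ) ≤ W) (hW1 : W ≤ ((J.snd : ℚ) : ℝ)) :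
    hPointN X W ∈ boxSet (castBox (boxN I J)) := by
  have hz := mem_boxSet_iff.mp axZero_mem
  rw [mem_boxSet_iff]
  intro i
  rw [castBox_apply, mem_ratCast_iff]
  by_cases hi : (i : ℕ) < 7
  · have h := hz ⟨i, by omega⟩
    rw [castBox_apply, mem_ratCast_iff] at h
    simp only [boxN, hPointN, hi, dif_pos]
    exact h
  · by_cases h7 : (i : ℕ) = 7
    · simp only [boxN, hPointN, h7, if_true]
      exact ⟨hlo, hhi⟩
    · simp only [boxN, hPointN, hi, h7, dif_neg, not_false_eq_true, if_false]
      exact ⟨hW0, hW1⟩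

/-! ## §3 The slope factor on the taller box; vertical valleys up to `|Y| = 8/5` -/

/-- **`H(X, Y²) ≥ 1/200` on `[11/50, 89/50] × (Y² ≤ 64/25)`.** -/
theorem vertSlope_lb_tall {X Y : ℝ} (h1 : (11 : ℝ) / 50 ≤ X) (h2 : X ≤ 89 / 50) (hY : Y ^ 2 ≤ 64 / 25) :
    1 / 200 ≤ vertG₂ CFNstxLike.coeff X + 2 * vertG₄ CFNstxLike.coeff X * Y ^ 2 + 3 * vertG₆ CFNstxLike.coeff X * Y ^ 4 := by
  obtain ⟨⟨a1, a2⟩, ⟨b1, b2⟩, ⟨c1, c2⟩, ⟨d1, d2⟩, -⟩ := piecesN_eq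
  obtain ⟨⟨w1, w2⟩, -⟩ := tall_eq
  have key : ∀ j : Fin 4, ((xPieceN j).fst : ℝ) ≤ X → X ≤ ((xPieceN j).snd : ℝ) →
      1 / 200 ≤ vertG₂ coeff X + 2 * vertG₄ coeff X * Y ^ 2 + 3 * vertG₆ coeff X * Y ^ 4 := by
    intro j hlo hhi
    have hW0 : ((wTall.fst : ℚ) : ℝ) ≤ Y ^ 2 := by rw [w1]; push_cast; positivity
    have hW1 : Y ^ 2 ≤ ((wTall.snd : ℚ) : ℝ) := by rw [w2]; push_cast; linarith
    have hmem := hPointN_mem_boxN hlo hhi hW0 hW1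
    have h := eval_mem_of_evalBoxLE (hTall_range_cert j) hmem
    rw [mem_ratCast_iff] at h
    have hev : CFIterLike.hExpr.eval (hPointN X (Y ^ 2))
        = vertG₂ coeff X + 2 * vertG₄ coeff X * Y ^ 2 + 3 * vertG₆ coeff X * Y ^ 4 := by
      rw [CFIterLike.eval_hExpr, hCoeffs_hPointN, hPointN_seven, hPointN_eight]; ring
    rw [hev] at h
    have : (((1 : ℚ) / 200 : ℚ) : ℝ) = 1 / 200 := by push_cast; ring
    linarith [h.1]
  by_cases ha : X ≤ 61 / 100
  · exact key 0 (by rw [a1]; push_cast; linarith) (by rw [a2]; push_cast; linarith)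
  by_cases hb : X ≤ 1
  · exact key 1 (by rw [b1]; push_cast; linarith) (by rw [b2]; push_cast; linarith)
  by_cases hc : X ≤ 139 / 100
  · exact key 2 (by rw [c1]; push_cast; linarith) (by rw [c2]; push_cast; linarith)
  · exact key 3 (by rw [d1]; push_cast; linarith) (by rw [d2]; push_cast; linarith)

/-- `|Y| ≤ 8/5` gives `Y² ≤ 64/25`. -/
theorem sq_le_tall {Y : ℝ} (hY : Y ∈ Icc (-(8 : ℝ) / 5) (8 / 5)) : Y ^ 2 ≤ 64 / 25 := by
  obtain ⟨h1, h2⟩ := hY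
  nlinarith

/-- In the taller box, `U_Y > 0` above the midplane. -/
theorem dZ_U_pos_tall {X Y : ℝ} (hX : X ∈ Icc (11 / 50 : ℝ) (89 / 50)) (hY : Y ∈ Icc (-(8 : ℝ) / 5) (8 / 5)) (hpos : 0 < Y) :
    0 < dZ CFNstxLike.U X Y := by
  have hH := vertSlope_lb_tall hX.1 hX.2 (sq_le_tall hY)
  rw [dZ_U_eq]
  have : 0 < vertG₂ coeff X + 2 * vertG₄ coeff X * Y ^ 2 + 3 * vertG₆ coeff X * Y ^ 4 := by linarith
  positivity

/-- In the taller box, `U_Y < 0` below the midplane. -/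
theorem dZ_U_neg_tall {X Y : ℝ} (hX : X ∈ Icc (11 / 50 : ℝ) (89 / 50)) (hY : Y ∈ Icc (-(8 : ℝ) / 5) (8 / 5)) (hneg : Y < 0) :
    dZ CFNstxLike.U X Y < 0 := by
  have hH := vertSlope_lb_tall hX.1 hX.2 (sq_le_tall hY)
  rw [dZ_U_eq]
  have hp : 0 < vertG₂ coeff X + 2 * vertG₄ coeff X * Y ^ 2 + 3 * vertG₆ coeff X * Y ^ 4 := by linarith
  nlinarith

/-- **Strict increase on `[0, 8/5]`.** -/
theorem strictMonoOn_U_vertical_tall {X : ℝ} (hX : X ∈ Icc (11 / 50 : ℝ) (89 / 50)) :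
    StrictMonoOn (CFNstxLike.U X) (Icc 0 (8 / 5 : ℝ)) := by
  apply strictMonoOn_of_deriv_pos (convex_Icc _ _) (continuous_U_vertical X).continuousOn
  intro y hy
  rw [interior_Icc] at hy
  have h : 0 < dZ U X y := dZ_U_pos_tall hX ⟨by linarith [hy.1], hy.2.le⟩ hy.1
  exact h

/-- **Strict decrease on `[−8/5, 0]`.** -/
theorem strictAntiOn_U_vertical_tall {X : ℝ} (hX : X ∈ Icc (11 / 50 : ℝ) (89 / 50)) :
    StrictAntiOn (CFNstxLike.U X) (Icc (-(8 : ℝ) / 5) 0) := by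
  apply strictAntiOn_of_deriv_neg (convex_Icc _ _) (continuous_U_vertical X).continuousOn
  intro y hy
  rw [interior_Icc] at hy
  have h : dZ U X y < 0 := dZ_U_neg_tall hX ⟨hy.1.le, by linarith [hy.2]⟩ hy.2
  exact h

/-! ## §4 The lid is vacuum: `U(X, ±8/5) ≥ 1/500` -/

/-- `U(X, Y)` through the vertical normal form (NSTX-like coefficients). -/
theorem U_eq_vert (X Y : ℝ) :
    CFNstxLike.U X Y = vertG₀ CFNstxLike.coeff X + vertG₂ CFNstxLike.coeff X * Y ^ 2 + vertG₄ CFNstxLike.coeff X * Y ^ 4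
      + vertG₆ CFNstxLike.coeff X * Y ^ 6 :=
  congrFun (U_vertical_eq X) Y

/-- **Up–down symmetry of the NSTX-like flux of record.** -/
theorem U_even (X Y : ℝ) : CFNstxLike.U X (-Y) = CFNstxLike.U X Y := by
  rw [U_eq_vert, U_eq_vert]; ring

/-- `U(X, Y) = U(X, |Y|)` (NSTX-like). -/
theorem U_abs (X Y : ℝ) : CFNstxLike.U X Y = CFNstxLike.U X |Y| := by
  rcases abs_choice Y with h | h
  · rw [h]
  · rw [h, U_even]

/-- **`U(X, 8/5) ≥ 1/500 > 0` for `11/50 ≤ X ≤ 89/50`.** -/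
theorem U_top_pos {X : ℝ} (h1 : (11 : ℝ) / 50 ≤ X) (h2 : X ≤ 89 / 50) : 1 / 500 ≤ CFNstxLike.U X (8 / 5) := by
  obtain ⟨-, ⟨v1, v2⟩⟩ := tall_eq
  have key : ∀ j : Fin 9, ((lidPieceN j).fst : ℝ) ≤ X → X ≤ ((lidPieceN j).snd : ℝ) → 1 / 500 ≤ CFNstxLike.U X (8 / 5) := by
    intro j hlo hhi
    have hW0 : ((wLidN.fst : ℚ) : ℝ) ≤ 64 / 25 := by rw [v1]; push_cast; norm_num
    have hW1 : (64 / 25 : ℝ) ≤ ((wLidN.snd : ℚ) : ℝ) := by rw [v2]; push_cast; norm_num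
    have hmem := hPointN_mem_boxN hlo hhi hW0 hW1
    have h := eval_mem_of_evalBoxLE (lidN_range_cert j) hmem
    rw [mem_ratCast_iff] at h
    have hev : CFIterLike.uExpr.eval (hPointN X (64 / 25)) = CFNstxLike.U X (8 / 5) := by
      rw [CFIterLike.eval_uExpr, hCoeffs_hPointN, hPointN_seven, hPointN_eight, U_eq_vert]; ring
    rw [hev] at h
    have : (((1 : ℚ) / 500 : ℚ) : ℝ) = 1 / 500 := by push_cast; ring
    linarith [h.1]
  obtain ⟨⟨l0, r0⟩, ⟨l1, r1⟩, ⟨l2, r2⟩, ⟨l3, r3⟩, ⟨l4, r4⟩, ⟨l5, r5⟩, ⟨l6, r6⟩, ⟨l7, r7⟩, ⟨l8, r8⟩⟩ := lidPieceN_eq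
  by_cases h0 : X ≤ 13 / 25
  · exact key 0 (by rw [l0]; push_cast; linarith) (by rw [r0]; push_cast; linarith)
  by_cases h1 : X ≤ 61 / 100
  · exact key 1 (by rw [l1]; push_cast; linarith) (by rw [r1]; push_cast; linarith)
  by_cases h2 : X ≤ 33 / 50
  · exact key 2 (by rw [l2]; push_cast; linarith) (by rw [r2]; push_cast; linarith)
  by_cases h3 : X ≤ 7 / 10
  · exact key 3 (by rw [l3]; push_cast; linarith) (by rw [r3]; push_cast; linarith)
  by_cases h4 : X ≤ 37 / 50
  · exact key 4 (by rw [l4]; push_cast; linarith) (by rw [r4]; push_cast; linarith)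
  by_cases h5 : X ≤ 79 / 100
  · exact key 5 (by rw [l5]; push_cast; linarith) (by rw [r5]; push_cast; linarith)
  by_cases h6 : X ≤ 87 / 100
  · exact key 6 (by rw [l6]; push_cast; linarith) (by rw [r6]; push_cast; linarith)
  by_cases h7 : X ≤ 109 / 100
  · exact key 7 (by rw [l7]; push_cast; linarith) (by rw [r7]; push_cast; linarith)
  · exact key 8 (by rw [l8]; push_cast; linarith) (by rw [r8]; push_cast; linarith)

/-- **`U(X, −8/5) ≥ 1/500`** as well. -/
theorem U_bottom_pos {X : ℝ} (h1 : (11 : ℝ) / 50 ≤ X) (h2 : X ≤ 89 / 50) : 1 / 500 ≤ CFNstxLike.U X (-(8 : ℝ) / 5) := by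
  rw [show (-(8 : ℝ) / 5) = -(8 / 5) by ring, U_even]; exact U_top_pos h1 h2

/-! ## §5 Every vertical section of the NSTX-like model plasma is one symmetric interval -/

/-- **THE NSTX-like PLASMA SECTION THEOREM** (box `[11/50, 89/50] × [−8/5, 8/5]`). -/
theorem plasma_section {X : ℝ} (hX : X ∈ Ioo (11 / 50 : ℝ) (89 / 50)) :
    ∃ Ys : ℝ, Ys ∈ Ioo (0 : ℝ) (8 / 5) ∧ CFNstxLike.U X Ys = 0 ∧
      (∀ Y : ℝ, Y ∈ Icc (-(8 : ℝ) / 5) (8 / 5) → (CFNstxLike.U X Y < 0 ↔ |Y| < Ys)) ∧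
      (∀ Y : ℝ, Y ∈ Icc (-(8 : ℝ) / 5) (8 / 5) → (CFNstxLike.U X Y = 0 ↔ |Y| = Ys)) := by
  have hXc : X ∈ Icc (11 / 50 : ℝ) (89 / 50) := ⟨hX.1.le, hX.2.le⟩
  have hneg : U X 0 < 0 := U_midplane_neg hX.1 hX.2
  have hpos : 0 < U X (8 / 5) := lt_of_lt_of_le (by norm_num) (U_top_pos hXc.1 hXc.2)
  have hcont : ContinuousOn (U X) (Icc 0 (8 / 5 : ℝ)) := (continuous_U_vertical X).continuousOn
  obtain ⟨Ys, hYs, hzero⟩ := intermediate_value_Ioo (by norm_num : (0 : ℝ) ≤ 8 / 5) hcont ⟨hneg, hpos⟩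
  have hmono := strictMonoOn_U_vertical_tall hXc
  have hYsI : Ys ∈ Icc (0 : ℝ) (8 / 5) := ⟨hYs.1.le, hYs.2.le⟩
  refine ⟨Ys, hYs, hzero, ?_, ?_⟩
  · intro Y hY
    have haI : |Y| ∈ Icc (0 : ℝ) (8 / 5) := ⟨abs_nonneg Y, abs_le.mpr ⟨by linarith [hY.1], hY.2⟩⟩
    rw [U_abs, ← hzero]
    exact hmono.lt_iff_lt haI hYsI
  · intro Y hY
    have haI : |Y| ∈ Icc (0 : ℝ) (8 / 5) := ⟨abs_nonneg Y, abs_le.mpr ⟨by linarith [hY.1], hY.2⟩⟩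
    rw [U_abs, ← hzero]
    exact ⟨fun h => hmono.injOn haI hYsI h, fun h => by rw [h]⟩

/-! ## §6 (APPENDED) The NSTX-like model plasma in the taller box AS A SET: the open lens under the graph of `Y⋆` -/

/-- The midplane is the valley floor of the taller box: `U(X, 0) < U(X, Y)` for `0 < |Y| ≤ 8/5`. -/
theorem U_midplane_lt_of_ne_tall {X Y : ℝ} (hX : X ∈ Icc (11 / 50 : ℝ) (89 / 50)) (hY : Y ∈ Icc (-(8 : ℝ) / 5) (8 / 5))
    (hne : Y ≠ 0) : CFNstxLike.U X 0 < CFNstxLike.U X Y := by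
  rcases lt_or_gt_of_ne hne with hlt | hgt
  · exact strictAntiOn_U_vertical_tall hX ⟨hY.1, hlt.le⟩ ⟨by norm_num, le_rfl⟩ hlt
  · exact strictMonoOn_U_vertical_tall hX ⟨le_rfl, by norm_num⟩ ⟨hgt.le, hY.2⟩ hgt

/-- On the two end lines of the NSTX-like chord the taller box meets no plasma. -/
theorem U_endlines_nonneg_tall {Y : ℝ} (hY : Y ∈ Icc (-(8 : ℝ) / 5) (8 / 5)) :
    0 ≤ CFNstxLike.U (11 / 50) Y ∧ 0 ≤ CFNstxLike.U (89 / 50) Y := by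
  have hl : (11 / 50 : ℝ) ∈ Icc (11 / 50 : ℝ) (89 / 50) := ⟨le_rfl, by norm_num⟩
  have hr : (89 / 50 : ℝ) ∈ Icc (11 / 50 : ℝ) (89 / 50) := ⟨by norm_num, le_rfl⟩
  obtain ⟨e1, e2⟩ := U_chord_ends
  by_cases h0 : Y = 0
  · subst h0; exact ⟨e1.symm.le, e2.symm.le⟩
  · exact ⟨by linarith [U_midplane_lt_of_ne_tall hl hY h0], by linarith [U_midplane_lt_of_ne_tall hr hY h0]⟩

/-- **The half-height `Y⋆(X)` of the NSTX-like model plasma** (from `plasma_section`; `0` off the open chord). -/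
def Ystar (X : ℝ) : ℝ :=
  if h : X ∈ Ioo (11 / 50 : ℝ) (89 / 50) then Classical.choose (plasma_section h) else 0

/-- The defining properties of the NSTX-like `Y⋆(X)`. -/
theorem Ystar_spec {X : ℝ} (hX : X ∈ Ioo (11 / 50 : ℝ) (89 / 50)) :
    CFNstxLike.Ystar X ∈ Ioo (0 : ℝ) (8 / 5) ∧ CFNstxLike.U X (CFNstxLike.Ystar X) = 0 ∧
      (∀ Y : ℝ, Y ∈ Icc (-(8 : ℝ) / 5) (8 / 5) → (CFNstxLike.U X Y < 0 ↔ |Y| < CFNstxLike.Ystar X)) ∧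
      (∀ Y : ℝ, Y ∈ Icc (-(8 : ℝ) / 5) (8 / 5) → (CFNstxLike.U X Y = 0 ↔ |Y| = CFNstxLike.Ystar X)) := by
  unfold Ystar
  rw [dif_pos hX]
  exact Classical.choose_spec (plasma_section hX)

/-- **THE NSTX-like MODEL PLASMA IN ITS TALLER BOUNDING BOX IS THE OPEN LENS `{11/50 < X < 89/50, |Y| < Y⋆(X)}`.** -/
theorem plasmaBox_eq :
    {p : ℝ × ℝ | p.1 ∈ Icc (11 / 50 : ℝ) (89 / 50) ∧ p.2 ∈ Icc (-(8 : ℝ) / 5) (8 / 5) ∧ CFNstxLike.U p.1 p.2 < 0}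
      = {p : ℝ × ℝ | p.1 ∈ Ioo (11 / 50 : ℝ) (89 / 50) ∧ |p.2| < CFNstxLike.Ystar p.1} := by
  ext p
  simp only [mem_setOf_eq]
  constructor
  · rintro ⟨hX, hY, hU⟩
    have h1 : (11 / 50 : ℝ) < p.1 := by
      rcases eq_or_lt_of_le hX.1 with h | h
      · exfalso
        have := (U_endlines_nonneg_tall hY).1
        rw [h] at this; linarith
      · exact h
    have h2 : p.1 < 89 / 50 := by
      rcases eq_or_lt_of_le hX.2 with h | h
      · exfalso
        have := (U_endlines_nonneg_tall hY).2
        rw [← h] at this; linarith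
      · exact h
    have hXo : p.1 ∈ Ioo (11 / 50 : ℝ) (89 / 50) := ⟨h1, h2⟩
    exact ⟨hXo, ((Ystar_spec hXo).2.2.1 p.2 hY).mp hU⟩
  · rintro ⟨hXo, hlt⟩
    have hs := Ystar_spec hXo
    have hY : p.2 ∈ Icc (-(8 : ℝ) / 5) (8 / 5) := by
      have hb : |p.2| < 8 / 5 := lt_trans hlt hs.1.2
      constructor <;> [linarith [(abs_lt.mp hb).1]; linarith [(abs_lt.mp hb).2]]
    exact ⟨⟨hXo.1.le, hXo.2.le⟩, hY, (hs.2.2.1 p.2 hY).mpr hlt⟩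

end Summit.Ventures.FusionMHD.Models.CFNstxLike
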